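import Literature.Probability.HypothesisTesting.NeymanPearsonLemma
import Literature.Computability.QuantumComplexity.CrossEntropyEstimators
import Literature.InformationTheory.Entropy.GibbsInequality
import HarnessLib

/-!
# The Bayesian / HOG-ratio validation scores of boson-sampling experiments

Topic `Literature/Computability/QuantumComplexity` (pub-qadeq lane, CLAIMS rows E-11…E-15 and
§5.1 S-4: the scores by which the USTC Gaussian-boson-sampling experiments ‘Jiuzhang’ 1.0 / 2.0 are
validated against NAMED classical mock-ups — thermal states, distinguishable photons, uniform — and
by which the spoofing literature compares its mock-up samplers with the experimental samples).

HONEST FRAMING: instance-level adjudication of specific advantage claims; no claim about BQP vs BPP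
or the summit.  This file TYPES three printed statistics as functions of the per-sample
probabilities under the two hypotheses and proves the algebraic identities between them that the
sources print or use; nothing is asserted about any experiment, device, mock-up or cost.

Sources (statements quoted from the materialised texts):

* [ZhongEtAl2021] H.-S. Zhong et al., *Phase-programmable Gaussian boson sampling using stimulated
  squeezed light*, Phys. Rev. Lett. **127**, 180502 (2021) = arXiv:2106.15534, p. 3, eq. (1):
  “In the standard Bayesian test [29], for each measured event k, we use Q_k and R_k to denote the
  probability associated with the GBS and a mockup sampler. We define Bayesian counter C_B as:
  C_B = χ_N/(χ_N + 1), where χ_N = ∏_{k=1}^{N} Q_k/R_k. (1)  χ_N > 1 indicates that the experimental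
  samples are more likely from the GBS than the mockup. … We further define Bayesian: ∆H =
  log χ_N/N, to measure the strength of the validation for unit samples.”
* [VillalongaEtAl2021] B. Villalonga, M. Y. Niu, L. Li, H. Neven, J. C. Platt, V. N. Smelyanskiy,
  S. Boixo, *Efficient approximation of experimental Gaussian boson sampling*, arXiv:2109.11525,
  §3 ‘Numerical results’ (the cross-entropy `XE(p, q) = −Σ_z p(z) log q(z)`, `D_KL(p,q) = XE(p,q) − H(p)`, and its
  sample estimate “XE ≃ −(1/n) log Pr(S_sampler) = −(1/n) Σ_{i=1}^{n} log[q(z_sampler,i)]”) and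
  Appendix ‘HOG rate and ∆XE’ (section 10 of the arXiv text): “the authors of Ref. [zhong_quantum_2020] define the HOG rate as
  the ratio r_HOG = Pr(S_experiment) / (Pr(S_experiment) + Pr(S_mockup)) … We can rewrite this
  expression as: r_HOG = 1/(1 + e^{n(XE_experiment − XE_mockup)}) = 1/(1 + e^{−n ∆XE})”.
  The HOG ratio test itself is introduced in the supplementary material of [ZhongEtAl2020]
  (H.-S. Zhong et al., *Quantum computational advantage using photons*, Science **370**, 1460
  (2020)), which is not held; it is formalised here from the restatement in [VillalongaEtAl2021].

## Contents (all proved, 0 named facts)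

* `xeHat qs = −(1/n) Σᵢ log qs i` — the sample cross-entropy of `n` samples with ideal
  probabilities `qs i` [cite: VillalongaEtAl2021, §3 (XE estimate)]; `logXEBHat_eq` — the tree's
  log-XEB estimator is `γ + ln N − xeHat`; `prSamples qs = ∏ᵢ qs i` (‘Pr(S)’) and
  `xeHat_eq_neg_log_prSamples` (“XE ≃ −(1/n) log Pr(S)”), `prSamples_eq_exp`.
* `hogRate a b = a/(a+b)` [cite: VillalongaEtAl2021, App. 10 (first display)] and
  **`hogRate_prSamples_eq_logistic`**: `r_HOG = 1/(1 + e^{n(XE_exp − XE_mock)})`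
  [cite: VillalongaEtAl2021, App. 10 (second display)].
* `bayesChi Q R = ∏ₖ Q k / R k`, `bayesCounter χ = χ/(χ+1)`, `bayesDeltaH Q R = log χ_N / N`
  [cite: ZhongEtAl2021, eq. (1)]; `bayesCounter_bayesChi_eq_hogRate` (the Bayesian counter is the
  HOG-rate expression of the two likelihoods of the SAME sample set), `log_bayesChi`,
  **`bayesDeltaH_eq_xeHat_sub`** (`∆H = XE of the samples under the mock-up − XE under GBS`),
  `bayesCounter_eq_logistic` (`C_B = 1/(1 + e^{−N ∆H})`), `one_lt_bayesChi_iff`,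
  `half_lt_bayesCounter_iff` (`C_B > 1/2 ↔ χ_N > 1 ↔ Pr_R(S) < Pr_Q(S)`), `bayesCounter_mono`.
* `sum_mul_log_sub_log_eq` — the population value of the per-sample score: for samples drawn from a
  law `P`, `E_P[log Q − log R] = D_KL(P‖R) − D_KL(P‖Q)` (finite sums, [cite: VillalongaEtAl2021,
  §3 eq. for D_KL]); hence `sum_mul_log_sub_log_nonneg` (ideal device `P = Q`: expected `∆H` is
  `D_KL(Q‖R) ≥ 0`, Gibbs) and `sum_mul_log_sub_log_nonpos` (device equal to the mock-up `P = R`: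
  expected `∆H` is `−D_KL(R‖Q) ≤ 0`).
* The decision ‘GBS rather than mock-up’ iff `χ_N > 1` is a LIKELIHOOD-RATIO TEST with threshold
  `k = 1` between the two product laws on sample sequences: `prodDensity`, `bayesDecision`,
  `isLRTest_bayesDecision`; hence, by the tree's Neyman–Pearson lemma
  (`Literature.Probability.HypothesisTesting.power_le_power_of_isLRTest`),
  `bayesDecision_mostPowerful`: no test on `N` samples with at most its false-acceptance rate under
  the mock-up `R` accepts the GBS hypothesis `Q` more often — an optimality RELATIVE TO THE NAMED `R`,
  which is all such a validation establishes; and `bayesDecision_advantage_le_tvDist`: its advantage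
  is at most `‖Q^{⊗N} − R^{⊗N}‖_TV`.
-/

noncomputable section

namespace Literature.Computability.QuantumComplexity.BayesianValidationTest

open Finset Real Literature.Probability.HypothesisTesting

variable {N : ℕ}

/-! ## Sample cross-entropy and the probability of a sample set -/

/-- The sample cross-entropy `XE ≃ −(1/n) Σᵢ log q(zᵢ)` of `n` samples whose ideal probabilities
are `qs i = q(zᵢ)` (minus the average log-likelihood). [cite: VillalongaEtAl2021, §3 (XE estimate)] -/
def xeHat (qs : Fin N → ℝ) : ℝ := -(∑ i, Real.log (qs i)) / N

/-- The tree's log-XEB estimator is `γ + ln M − XE` on the same samples. [cite: VillalongaEtAl2021, §3] -/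
theorem logXEBHat_eq (M : ℕ) (qs : Fin N → ℝ) :
    XEB.logXEBHat M qs = Real.eulerMascheroniConstant + Real.log M - xeHat qs := by
  unfold XEB.logXEBHat xeHat; ring

/-- `Pr(S) = ∏ᵢ q(zᵢ)`: the probability the ground truth assigns to the (ordered) sample set.
[cite: VillalongaEtAl2021, App. 10] -/
def prSamples (qs : Fin N → ℝ) : ℝ := ∏ i, qs i

/-- `Pr(S) > 0` when every sample has positive ground-truth probability. [cite: VillalongaEtAl2021, App. 10 (Pr(S))] -/
theorem prSamples_pos {qs : Fin N → ℝ} (hq : ∀ i, 0 < qs i) : 0 < prSamples qs :=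
  prod_pos fun i _ => hq i

/-- “XE ≃ −(1/n) log Pr(S_sampler)”. [cite: VillalongaEtAl2021, §3 (XE estimate, first line)] -/
theorem xeHat_eq_neg_log_prSamples {qs : Fin N → ℝ} (hq : ∀ i, 0 < qs i) :
    xeHat qs = -Real.log (prSamples qs) / N := by
  unfold xeHat prSamples
  rw [Real.log_prod fun i _ => (hq i).ne']

/-- `Pr(S) = e^{−n·XE}` for `n ≥ 1` samples of positive probability. [cite: VillalongaEtAl2021, App. 10] -/
theorem prSamples_eq_exp {qs : Fin N → ℝ} (hq : ∀ i, 0 < qs i) (hN : 0 < N) :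
    prSamples qs = Real.exp (-(N * xeHat qs)) := by
  rw [xeHat_eq_neg_log_prSamples hq]
  have hN' : (N : ℝ) ≠ 0 := by exact_mod_cast hN.ne'
  rw [mul_div_cancel₀ _ hN', neg_neg, Real.exp_log (prSamples_pos hq)]

/-! ## The HOG rate of Zhong et al. (2020) -/

/-- `r_HOG = Pr(S_experiment) / (Pr(S_experiment) + Pr(S_mockup))`.
[cite: VillalongaEtAl2021, App. 10 (first display); ZhongEtAl2020, SOM (HOG ratio test)] -/
def hogRate (prE prM : ℝ) : ℝ := prE / (prE + prM)

/-- `0 ≤ r_HOG` for non-negative probabilities. [cite: VillalongaEtAl2021, App. 10 (first display)] -/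
theorem hogRate_nonneg {a b : ℝ} (ha : 0 ≤ a) (hb : 0 ≤ b) : 0 ≤ hogRate a b :=
  div_nonneg ha (add_nonneg ha hb)

/-- `r_HOG ≤ 1` for non-negative probabilities. [cite: VillalongaEtAl2021, App. 10 (first display)] -/
theorem hogRate_le_one {a b : ℝ} (ha : 0 ≤ a) (hb : 0 ≤ b) : hogRate a b ≤ 1 := by
  unfold hogRate
  rcases (add_nonneg ha hb).eq_or_lt with h | h
  · rw [← h, div_zero]; exact zero_le_one
  · rw [div_le_one h]; linarith

/-- `a/(a+b) = 1/(1 + b/a)` for `a > 0` (plumbing). [folklore] -/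
private theorem hogRate_eq_one_div {a b : ℝ} (ha : 0 < a) : hogRate a b = 1 / (1 + b / a) := by
  unfold hogRate
  field_simp

/-- **`r_HOG = 1/(1 + e^{n (XE_experiment − XE_mockup)})`** for two sets of `n ≥ 1` samples with
positive ground-truth probabilities `qE` (experiment) and `qM` (mock-up).
[cite: VillalongaEtAl2021, App. 10 (second display)] -/
theorem hogRate_prSamples_eq_logistic {qE qM : Fin N → ℝ} (hE : ∀ i, 0 < qE i)
    (hM : ∀ i, 0 < qM i) (hN : 0 < N) :
    hogRate (prSamples qE) (prSamples qM) =
      1 / (1 + Real.exp (N * (xeHat qE - xeHat qM))) := by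
  rw [hogRate_eq_one_div (prSamples_pos hE), prSamples_eq_exp hE hN, prSamples_eq_exp hM hN,
    ← Real.exp_sub]
  congr 2; ring

/-! ## The Bayesian counter of Zhong et al. (2021) -/

/-- `χ_N = ∏ₖ Q_k / R_k` — the likelihood ratio of the `N` measured events under the GBS
hypothesis (`Q`) and the mock-up hypothesis (`R`). [cite: ZhongEtAl2021, eq. (1)] -/
def bayesChi (Q R : Fin N → ℝ) : ℝ := ∏ k, Q k / R k

/-- `C_B = χ/(χ + 1)` — “the probability that the samples are from the GBS after testing N
events” (equal prior weights). [cite: ZhongEtAl2021, eq. (1)] -/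
def bayesCounter (χ : ℝ) : ℝ := χ / (χ + 1)

/-- `∆H = log χ_N / N` — “the strength of the validation for unit samples”. [cite: ZhongEtAl2021, p. 3 (after eq. (1))] -/
def bayesDeltaH (Q R : Fin N → ℝ) : ℝ := Real.log (bayesChi Q R) / N

/-- `χ_N = Pr_Q(S) / Pr_R(S)`: the product of the ratios is the ratio of the two likelihoods of the
sample set. [cite: ZhongEtAl2021, eq. (1)] -/
theorem bayesChi_eq_div (Q R : Fin N → ℝ) : bayesChi Q R = prSamples Q / prSamples R := by
  unfold bayesChi prSamples; rw [prod_div_distrib]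

/-- `χ_N > 0` for positive likelihoods. [cite: ZhongEtAl2021, eq. (1)] -/
theorem bayesChi_pos {Q R : Fin N → ℝ} (hQ : ∀ k, 0 < Q k) (hR : ∀ k, 0 < R k) :
    0 < bayesChi Q R :=
  prod_pos fun k _ => div_pos (hQ k) (hR k)

/-- The Bayesian counter is the HOG-rate expression `Pr_Q(S)/(Pr_Q(S) + Pr_R(S))` of the two
likelihoods of the same sample set. [cite: ZhongEtAl2021, eq. (1); VillalongaEtAl2021, App. 10] -/
theorem bayesCounter_bayesChi_eq_hogRate {Q R : Fin N → ℝ} (hR : ∀ k, 0 < R k) :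
    bayesCounter (bayesChi Q R) = hogRate (prSamples Q) (prSamples R) := by
  rw [bayesChi_eq_div]
  unfold bayesCounter hogRate
  have hR' : prSamples R ≠ 0 := (prSamples_pos hR).ne'
  field_simp

/-- `log χ_N = Σₖ (log Q_k − log R_k)`. [cite: ZhongEtAl2021, eq. (1)] -/
theorem log_bayesChi {Q R : Fin N → ℝ} (hQ : ∀ k, 0 < Q k) (hR : ∀ k, 0 < R k) :
    Real.log (bayesChi Q R) = ∑ k, (Real.log (Q k) - Real.log (R k)) := by
  unfold bayesChi
  rw [Real.log_prod fun k _ => (div_pos (hQ k) (hR k)).ne']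
  exact sum_congr rfl fun k _ => Real.log_div (hQ k).ne' (hR k).ne'

/-- **`∆H = XE_R − XE_Q`**: Zhong et al.'s per-sample Bayesian score is the difference of the two
sample cross-entropies of the SAME events, under the mock-up and under the GBS ground truth.
[cite: ZhongEtAl2021, eq. (1); VillalongaEtAl2021, §3 (XE estimate)] -/
theorem bayesDeltaH_eq_xeHat_sub {Q R : Fin N → ℝ} (hQ : ∀ k, 0 < Q k) (hR : ∀ k, 0 < R k) :
    bayesDeltaH Q R = xeHat R - xeHat Q := by
  unfold bayesDeltaH xeHat
  rw [log_bayesChi hQ hR, sum_sub_distrib]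
  ring

/-- `C_B = 1/(1 + e^{−N ∆H})` (`N ≥ 1`): the Bayesian counter is the logistic function of the
accumulated score. [cite: ZhongEtAl2021, eq. (1); VillalongaEtAl2021, App. 10] -/
theorem bayesCounter_eq_logistic {Q R : Fin N → ℝ} (hQ : ∀ k, 0 < Q k) (hR : ∀ k, 0 < R k)
    (hN : 0 < N) :
    bayesCounter (bayesChi Q R) = 1 / (1 + Real.exp (-(N * bayesDeltaH Q R))) := by
  rw [bayesCounter_bayesChi_eq_hogRate hR, hogRate_prSamples_eq_logistic hQ hR hN,
    bayesDeltaH_eq_xeHat_sub hQ hR]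
  congr 3; ring

/-- “χ_N > 1 indicates that the experimental samples are more likely from the GBS than the
mockup”: `χ_N > 1 ↔ Pr_R(S) < Pr_Q(S)`. [cite: ZhongEtAl2021, p. 3 (after eq. (1))] -/
theorem one_lt_bayesChi_iff {Q R : Fin N → ℝ} (hR : ∀ k, 0 < R k) :
    1 < bayesChi Q R ↔ prSamples R < prSamples Q := by
  rw [bayesChi_eq_div, one_lt_div (prSamples_pos hR)]

/-- `C_B > 1/2 ↔ χ > 1` (for `χ ≥ 0`). [cite: ZhongEtAl2021, eq. (1)] -/
theorem half_lt_bayesCounter_iff {χ : ℝ} (hχ : 0 ≤ χ) : 1 / 2 < bayesCounter χ ↔ 1 < χ := by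
  unfold bayesCounter
  have h1 : 0 < χ + 1 := by linarith
  rw [lt_div_iff₀ h1]
  constructor <;> intro h <;> linarith

/-- `C_B` is monotone in `χ ≥ 0` (“C_B grows rapidly and reaches over 99.6% after 50-100 events” is a
statement about growing `χ_N`). [cite: ZhongEtAl2021, eq. (1) and p. 3] -/
theorem bayesCounter_mono {a b : ℝ} (ha : 0 ≤ a) (hab : a ≤ b) :
    bayesCounter a ≤ bayesCounter b := by
  unfold bayesCounter
  have h1 : 0 < a + 1 := by linarith
  have h2 : 0 < b + 1 := by linarith
  rw [div_le_div_iff₀ h1 h2]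
  nlinarith

/-- `0 ≤ C_B` (“C_B is the probability that the samples are from the GBS”). [cite: ZhongEtAl2021, eq. (1)] -/
theorem bayesCounter_nonneg {χ : ℝ} (hχ : 0 ≤ χ) : 0 ≤ bayesCounter χ :=
  div_nonneg hχ (by linarith)

/-- `C_B < 1` for every finite `χ_N`. [cite: ZhongEtAl2021, eq. (1)] -/
theorem bayesCounter_lt_one {χ : ℝ} (hχ : 0 ≤ χ) : bayesCounter χ < 1 := by
  unfold bayesCounter; rw [div_lt_one (by linarith)]; linarith

/-! ## Population value of the per-sample score -/

section Population

variable {Z : Type*} [Fintype Z]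

/-- For events drawn from a law `P`, the expected per-sample score `E_P[log Q − log R]` equals
`D_KL(P‖R) − D_KL(P‖Q)` (finite sums; `D_KL(p,q) = Σ p log(p/q) = XE(p,q) − H(p)`).
[cite: VillalongaEtAl2021, §3 (eq. for D_KL and XE)] -/
theorem sum_mul_log_sub_log_eq {P Q R : Z → ℝ} (hP : ∀ z, 0 < P z) (hQ : ∀ z, 0 < Q z)
    (hR : ∀ z, 0 < R z) :
    ∑ z, P z * (Real.log (Q z) - Real.log (R z)) =
      (∑ z, P z * Real.log (P z / R z)) - ∑ z, P z * Real.log (P z / Q z) := by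
  rw [← sum_sub_distrib]
  refine sum_congr rfl fun z _ => ?_
  rw [Real.log_div (hP z).ne' (hR z).ne', Real.log_div (hP z).ne' (hQ z).ne']
  ring

/-- Ideal device (`P = Q`): the expected per-sample score against any mock-up `R` is
`D_KL(Q‖R) ≥ 0` (Gibbs' inequality, tree `sum_mul_log_div_nonneg`; “The KL divergence is a
non-symmetric distance between two distributions”). [cite: VillalongaEtAl2021, §3 (eq. for D_KL)] -/
theorem sum_mul_log_sub_log_nonneg {Q R : Z → ℝ} (hQ : ∀ z, 0 < Q z) (hR : ∀ z, 0 < R z)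
    (hmass : ∑ z, Q z = ∑ z, R z) :
    0 ≤ ∑ z, Q z * (Real.log (Q z) - Real.log (R z)) := by
  rw [sum_mul_log_sub_log_eq hQ hQ hR]
  have h0 : ∑ z, Q z * Real.log (Q z / Q z) = 0 :=
    sum_eq_zero fun z _ => by rw [div_self (hQ z).ne', Real.log_one, mul_zero]
  rw [h0, sub_zero]
  exact Literature.InformationTheory.Entropy.sum_mul_log_div_nonneg (fun z => (hQ z).le) hR hmass

/-- Device equal to the mock-up (`P = R`): the expected per-sample score is `−D_KL(R‖Q) ≤ 0`.
[cite: VillalongaEtAl2021, §3 (eq. for D_KL)] -/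
theorem sum_mul_log_sub_log_nonpos {Q R : Z → ℝ} (hQ : ∀ z, 0 < Q z) (hR : ∀ z, 0 < R z)
    (hmass : ∑ z, R z = ∑ z, Q z) :
    ∑ z, R z * (Real.log (Q z) - Real.log (R z)) ≤ 0 := by
  have h := sum_mul_log_sub_log_nonneg hR hQ hmass
  have : ∑ z, R z * (Real.log (Q z) - Real.log (R z)) =
      -∑ z, R z * (Real.log (R z) - Real.log (Q z)) := by
    rw [← sum_neg_distrib]; exact sum_congr rfl fun z _ => by ring
  rw [this]; linarith

end Population

/-! ## The Bayesian decision is a likelihood-ratio test between the product laws -/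

section Decision

variable {Z : Type*} [Fintype Z]

/-- The product density `s ↦ ∏ₖ q(sₖ)` of `N` independent events on sequences `s : Fin N → Z`.
[cite: ZhongEtAl2021, eq. (1) (the product over the N measured events)] -/
def prodDensity (q : Z → ℝ) (s : Fin N → Z) : ℝ := ∏ k, q (s k)

omit [Fintype Z] in
/-- The product density of a sequence is `Pr(S)` of its per-event probabilities (plumbing). [folklore] -/
private theorem prodDensity_eq_prSamples (q : Z → ℝ) (s : Fin N → Z) :
    prodDensity q s = prSamples (fun k => q (s k)) := rfl

omit [Fintype Z] in
/-- The product density is positive for a positive law. [cite: ZhongEtAl2021, eq. (1) (the product over the N events)] -/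
theorem prodDensity_pos {q : Z → ℝ} (hq : ∀ z, 0 < q z) (s : Fin N → Z) : 0 < prodDensity q s :=
  prod_pos fun _ _ => hq _

/-- `Σ_s ∏ₖ q(sₖ) = (Σ_z q z)^N`; in particular the product density of a probability vector is a
probability vector on sequences (plumbing, `Fintype.sum_pow`). [folklore] -/
private theorem sum_prodDensity (q : Z → ℝ) : ∑ s : Fin N → Z, prodDensity q s = (∑ z, q z) ^ N := by
  unfold prodDensity
  exact (Fintype.sum_pow q N).symm

/-- The non-randomised decision “GBS” iff `χ_N > 1`, i.e. iff `∏ R(sₖ) < ∏ Q(sₖ)`, as a test on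
sample sequences (`1` = decide for the GBS hypothesis `Q`). [cite: ZhongEtAl2021, p. 3 (“χ_N > 1
indicates that the experimental samples are more likely from the GBS than the mockup”)] -/
def bayesDecision (Q R : Z → ℝ) (s : Fin N → Z) : ℝ :=
  if prodDensity R s < prodDensity Q s then 1 else 0

omit [Fintype Z] in
/-- The decision is ‘GBS’ exactly when `χ_N > 1`. [cite: ZhongEtAl2021, p. 3 (after eq. (1))] -/
theorem bayesDecision_eq_one_iff {Q R : Z → ℝ} (hR : ∀ z, 0 < R z) (s : Fin N → Z) :
    bayesDecision Q R s = 1 ↔ 1 < bayesChi (fun k => Q (s k)) (fun k => R (s k)) := by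
  rw [one_lt_bayesChi_iff fun k => hR _]
  unfold bayesDecision
  rw [← prodDensity_eq_prSamples, ← prodDensity_eq_prSamples]
  split_ifs with h <;> simp [h]

omit [Fintype Z] in
/-- The decision by the sign of `log χ_N` is a likelihood-ratio test with threshold `k = 1` for
testing the mock-up product law `R^{⊗N}` against the GBS product law `Q^{⊗N}` (form (3.8) with
`p₀ = R^{⊗N}`, `p₁ = Q^{⊗N}`, `k = 1`). [cite: LehmannRomano2005, §3.2 Theorem 3.2.1 eq. (3.8) (k = 1); ZhongEtAl2021, eq. (1)] -/
theorem isLRTest_bayesDecision (Q R : Z → ℝ) :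
    IsLRTest (prodDensity (N := N) R) (prodDensity Q) 1 (bayesDecision Q R) := by
  refine ⟨fun s => ?_, fun s hs => ?_, fun s hs => ?_⟩
  · unfold bayesDecision; split_ifs <;> simp
  · rw [one_mul] at hs; simp [bayesDecision, hs]
  · rw [one_mul] at hs; simp [bayesDecision, not_lt.mpr hs.le]

/-- **Optimality relative to the named mock-up (Neyman–Pearson).**  Among all (randomised) tests
on `N`-event sequences whose acceptance rate of ‘GBS’ under the mock-up law `R^{⊗N}` does not
exceed that of the Bayesian decision, none accepts ‘GBS’ more often under `Q^{⊗N}`.  (This is what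
the validation is optimal FOR: discriminating `Q` from THIS `R`.) [cite: LehmannRomano2005, §3.2 Theorem 3.2.1 (ii)] -/
theorem bayesDecision_mostPowerful (Q R : Z → ℝ) {φ : (Fin N → Z) → ℝ} (hφ : IsTest φ)
    (hsize : rejProb (prodDensity (N := N) R) φ ≤
      rejProb (prodDensity (N := N) R) (bayesDecision Q R)) :
    rejProb (prodDensity (N := N) Q) φ ≤ rejProb (prodDensity (N := N) Q) (bayesDecision Q R) :=
  power_le_power_of_isLRTest (isLRTest_bayesDecision Q R) zero_le_one hφ hsize

/-- The advantage `Pr_Q(decide GBS) − Pr_R(decide GBS)` of the Bayesian decision — indeed of any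
test on `N` events — is at most the total variation distance of the two product laws (for
probability vectors `Q`, `R`; the tree's `power_sub_size_le_tvDist`). [cite: LehmannRomano2005, §3.2 Theorem 3.2.1 (ii) (k = 1); LevinPeres2017, Remark 4.3 eq. (4.5)] -/
theorem bayesDecision_advantage_le_tvDist [DecidableEq Z] {Q R : Z → ℝ} (hQ1 : ∑ z, Q z = 1)
    (hR1 : ∑ z, R z = 1) {φ : (Fin N → Z) → ℝ} (hφ : IsTest φ) :
    rejProb (prodDensity (N := N) Q) φ - rejProb (prodDensity (N := N) R) φ ≤
      Literature.Probability.MarkovChains.tvDist (prodDensity (N := N) Q) (prodDensity (N := N) R) :=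
  power_sub_size_le_tvDist
    (by rw [sum_prodDensity (N := N) Q, sum_prodDensity (N := N) R, hQ1, hR1]) hφ

end Decision

end Literature.Computability.QuantumComplexity.BayesianValidationTest
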